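import Literature.Analysis.FluidPDE.TaoAveragedSobolev
import HarnessLib

/-!
# Barrier: finite-time blow-up for an averaged Navier–Stokes equation (Tao 2016)

Barrier catalogue entry for `NavierStokesRegularity` (D-0021). The main declaration
`TaoAveragedBlowup` is *definitionally* the in-tree named fact
`Literature.Analysis.FluidPDE.Tao2016.averagedNS_blowup`
(`Literature/Analysis/FluidPDE/TaoAveragedSobolev.lean`; `taoAveragedBlowup_iff`) — T. Tao's
Theorem 1.5 **as printed**, over his own objects: `L²(ℝ³)`-valued fields, `H¹⁰_df(ℝ³)` through
the Fourier–Sobolev norm, random real Fourier multipliers of order `0` with *complex* Hermitian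
symbols `m(-ξ) = \overline{m(ξ)}` and moment bounds, rotations in `SO(3)`, dilations
`λ^{3/2} u(λ·)` with `λ ∈ [C⁻¹, C]`, the duality-defined form (1.13) and mild solutions (1.15) —
and this file adds to it only the structured barrier docstring (`technique_class` / `blocks` /
`because` / `evasions_known` / `scope_caveats` / `status`) that the gate indexes. That fact is a
**theorem of the tree**: `Literature.Analysis.FluidPDE.Tao2016.averagedNS_blowup_holds`
(`Literature/Analysis/FluidPDE/TaoAveragedCascadeHolds.lean`, assembled along the printed proof,
"Theorem 1.5 is then an immediate consequence of [Theorems 3.2 and 3.3]", §3 p. 14); the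
catalogue-side discharges `TaoAveragedBlowup_holds` and `TaoAveragedBlowupPrinted_holds` live in
the sibling `TaoAveragedBlowupProofs.lean`, which imports the whole reduction chain so that this
entry — the file the routes cite — stays light (as for `SingularSetDimensionBoundHolds.lean` in
this directory).

## History of the entry (why there are two names)

Until 2026-08-15 the body of `TaoAveragedBlowup` was the tree's older *function-level* rendering
`Literature.Analysis.FluidPDE.tao_averaged_ns_blowup` (`Literature/Analysis/FluidPDE/TaoAveraged.lean`,
over the prelude `TaoAveragedEuler.lean`). Its prove-seats (2026-08-14/15) found, and the source
confirms, that this rendering is **not the printed theorem**, in two respects: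

1. *Symbol class.* Tao's real Fourier multipliers of order `0` (the class `𝓜₀`, §1.1 p. 6) have
   complex symbols `m : ℝ³ → ℂ`, smooth off the origin with all seminorms (1.10) finite, subject
   to the reality condition `m(-ξ) = \overline{m(ξ)}` — an even real part *and an odd imaginary
   part*, and the proof of his Thm. 3.2 uses the odd ones (§3.1, p. 15, "taking real parts" of
   complex averages). The prelude's `TaoAverageData.m` is real-valued and `multiplierApply`
   (`Re 𝓕⁻(m û)`) keeps only the even part of `m`, so the function-level class
   `IsAveragedEulerBilinear` does not contain Tao's, and Tao's own witness (the local cascade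
   operator of §4, (4.1)) lies outside it; in the other direction that class is *wider* than
   (1.13) (no moment bounds, no dilation bounds `C⁻¹ ≤ λᵢ ≤ C`, free dilation exponent, any
   linear isometry instead of `SO(3)`).
2. *Solution concept.* Tao's `B̃ : H¹⁰_df × H¹⁰_df → (H¹⁰_df)*` is defined by duality
   ((1.12)–(1.13)) and a mild solution is a continuous map `u : I → H¹⁰_df(ℝ³)` obeying (1.15) in
   that space; the prelude pins `B = 𝒜.op` on *all* everywhere-defined fields through pointwise
   Bochner/Fourier surrogates (junk `0` off `L¹`) and a pointwise Duhamel identity.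

Neither statement implies the other, and no source proves the function-level one. The printed
theorem was therefore vendored as `Tao2016.averagedNS_blowup` and re-exported here on 2026-08-14
under the second name `TaoAveragedBlowupPrinted`, while the entry kept its old body because routes
cite the entry; on 2026-08-15 the function-level facts `tao_averaged_ns_blowup` and
`exists_not_averagedNSGlobalRegularity` were `@[deprecated]` in their own file (mis-stated), in
favour of `Tao2016.averagedNS_blowup` / `Tao2016.exists_not_globalRegularity`.

**Verdict clean-up of this entry (2026-08-15; human ruling "restate, do not delete").** The entry
`TaoAveragedBlowup` keeps its NAME and now has the printed theorem as its BODY. The name is the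
catalogue key (`Literature.Barriers.NavierStokesRegularity.TaoAveragedBlowup`) addressed by the
`NavierStokesRegularity` routes and cited by the sibling entries `EnergySupercriticality`,
`TruncatedDyadicBlowup`, `TruncatedDyadicTypeIBlowup` and `DyadicCascadeRegularity` — in every
case for Theorem 1.5 as printed, which is what the entry's docstring has always stated — and the
declaration had no term-level user (its only importer, `TaoAveragedBlowupProofs.lean`, uses
`TaoAveragedBlowupPrinted`), so the correction is meaning-preserving for all users. The restated
entry is discharged under its own name, `TaoAveragedBlowup_holds` (appended to the sibling
`TaoAveragedBlowupProofs.lean` the same day), so that neither `Prop` definition of this file is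
open literature debt; a second verdict pass (2026-08-15) re-checked both defects of the old body
and the new body against the held text (p. 6: complex symbols with `m(-ξ) = \overline{m(ξ)}`,
`SO(3)`, `λ^{3/2}`, the bounds of (1.13); p. 7: (1.15), (1.16) and Thm. 1.5 verbatim) and changed
no statement. The mis-stated
function-level statement, of which the old body was a verbatim duplicate, survives only as the
deprecated `Literature.Analysis.FluidPDE.tao_averaged_ns_blowup`; nothing here depends on it any
more (`Literature.Analysis.FluidPDE.TaoAveraged` is no longer imported, and the corollary over the
deprecated `exists_not_averagedNSGlobalRegularity` is replaced by
`TaoAveragedBlowup.exists_not_globalRegularity`). `TaoAveragedBlowupPrinted` stays, unchanged, as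
a definitional synonym of the entry (`taoAveragedBlowupPrinted_iff_taoAveragedBlowup`), because
the sibling discharge file and ledger items name it; new references should use
`TaoAveragedBlowup`.

## What is printed (T. Tao, J. Amer. Math. Soc. 29 (2016), 601–674 = arXiv:1402.0290v3, held as `paper:arxiv-1402.0290`; page numbers of that text)

* §1.1, Thm. 1.5 (p. 7; Finite time blowup for an averaged Navier–Stokes equation): there exist
  a symmetric averaged Euler bilinear operator `B̃ : H¹⁰_df(ℝ³) × H¹⁰_df(ℝ³) → H¹⁰_df(ℝ³)*`
  (an average, over rotations, dilations and order-zero Fourier multipliers, of conjugates of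
  the Euler bilinear form `B(u,v) = -½ P[(u·∇)v + (v·∇)u]`) obeying the cancellation property
  `⟨B̃(u,u), u⟩ = 0` for all `u ∈ H¹⁰_df(ℝ³)`, and a Schwartz divergence-free vector field `u₀`,
  such that there is no global-in-time mild solution `u : [0,+∞) → H¹⁰_df(ℝ³)` to the averaged
  Navier–Stokes equation `∂ₜu = Δu + B̃(u,u)` with initial data `u₀`.
* §1.1, p. 5 and the paragraph after Thm. 1.5 (p. 8): `B̃` "has equal or lesser strength from
  a harmonic analysis point of view (indeed, `B̃` obeys slightly more estimates than `B` does)"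
  and still obeys the energy identity; "any strategy that fails to distinguish between the Euler
  bilinear operator `B` and its averaged counterparts `B̃` … is doomed to failure"; the barrier
  "does not rule out arguments that crucially exploit specific properties of the Navier–Stokes
  equation that are not shared by the averaged versions", naming the backwards unique
  continuation argument of Escauriaza–Seregin–Šverák and the slowly-varying large-data solutions
  of Chemin–Gallagher–Paicu (Ann. of Math. 173 (2011), Tao's [chemin]); the blow-up constructed is
  of Type II (footnote, p. 8); Tao calls the result "a significant (but not completely
  inpenetrable) barrier" (p. 8).
* §1.1, pp. 6–7 (definition of averaged Euler bilinear operators): random real order-`0`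
  multipliers (complex symbols with `m(-ξ) = \overline{m(ξ)}`), rotations in `SO(3)`, dilations
  `Dil_λ u(x) = λ^{3/2} u(λx)` with `C⁻¹ ≤ λᵢ ≤ C`, and moment bounds
  `𝔼 ‖m₁‖_{k₁}‖m₂‖_{k₂}‖m₃‖_{k₃} < ∞`; "every estimate on the Euler bilinear operator `B` in
  Sobolev spaces `W^{s,p}(ℝ³)` with `1 < p < ∞` implies a corresponding estimate for averaged
  Euler bilinear operators `B̃`", similarly in Hölder, Besov, Morrey spaces, with a possible
  exception for endpoint spaces `L¹`, `L^∞`, `L^{1,∞}` (footnote, p. 7). The entry's hypothesis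
  structure `Literature.Analysis.FluidPDE.Tao2016.AveragingDatum` encodes all of these data
  (complex Hermitian order-`0` symbols, `SO(3)` as `det = 1` isometries, exponent `3/2`, the
  bounds on `λᵢ`, the moment bounds); it records the measurability of `ω ↦ m_{i,ω}` pointwise in
  `ξ ≠ 0` rather than as a Borel map into the Fréchet space `𝓜₀` (implied by Tao's; see
  `scope_caveats` (vi)).
* §1.1, p. 5: earlier model blow-ups *without* the energy identity — the cheap Navier–Stokes
  equation of Montgomery-Smith (2001), its vector version by Gallagher–Paicu (2009), and the
  complexified Navier–Stokes blow-up of Li–Sinai (2008).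

## References

* T. Tao, *Finite time blowup for an averaged three-dimensional Navier–Stokes equation*,
  J. Amer. Math. Soc. 29 (2016), 601–674; arXiv:1402.0290. [`Tao2016AveragedNS`]
* J.-Y. Chemin, I. Gallagher, M. Paicu, Ann. of Math. 173 (2011), 983–1012.
  [`CheminGallagherPaicu2011`]
* S. Montgomery-Smith, *Finite time blow up for a Navier–Stokes like equation*, Proc. Amer.
  Math. Soc. 129 (2001), 3025–3029. [`MontgomerySmith2001`]
* L. Escauriaza, G. Seregin, V. Šverák, Russ. Math. Surveys 58 (2003).
  [`EscauriazaSereginSverak2003`]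
-/

namespace Literature.Barriers.NavierStokesRegularity

/-- **Barrier (Tao 2016): blow-up for an averaged Navier–Stokes equation obeying the energy
identity — Theorem 1.5 as printed.** There exist a symmetric averaged Euler bilinear operator
`B̃ : H¹⁰_df(ℝ³) × H¹⁰_df(ℝ³) → H¹⁰_df(ℝ³)*` — `⟨B̃(u,v), w⟩ = 𝒜.form u v w` for an averaging
datum `𝒜` as in (1.12)–(1.13) (accepted `Literature.Analysis.FluidPDE.Tao2016.AveragingDatum`:
random real Fourier multipliers of order `0` with complex Hermitian symbols and moment bounds,
random rotations in `SO(3)`, random dilations `λ^{3/2} u(λ·)` with `λ ∈ [C⁻¹, C]`), symmetric on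
`H¹⁰_df` (`AveragingDatum.IsSymmetric`) — obeying the cancellation property (1.16)
`⟨B̃(u,u), u⟩ = 0` for all `u ∈ H¹⁰_df(ℝ³)` (`AveragingDatum.HasCancellation`), and a Schwartz
divergence-free datum `u₀ : 𝓢(ℝ³, ℝ³)`, such that the averaged Navier–Stokes equation (1.9)
`∂ₜu = Δu + B̃(u,u)`, `u(0) = u₀` has **no** global-in-time mild solution
`u : [0,+∞) → H¹⁰_df(ℝ³)` ((1.15), `AveragingDatum.IsMildSolution _ (Ici 0)`). Definitionally the
in-tree named fact `Literature.Analysis.FluidPDE.Tao2016.averagedNS_blowup` (`taoAveragedBlowup_iff`),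
which is proved in the tree (`Tao2016.averagedNS_blowup_holds`, along the printed proof
Thm. 1.5 ⇐ Thm. 3.2 + Thm. 3.3; catalogue-side discharge `TaoAveragedBlowup_holds` in the sibling
`TaoAveragedBlowupProofs.lean`). Until 2026-08-15 this body was the function-level rendering
`Literature.Analysis.FluidPDE.tao_averaged_ns_blowup`, deprecated as mis-stated (module docstring,
*History*, and `scope_caveats` (vii)); the definitional synonym `TaoAveragedBlowupPrinted` below
dates from that period. [cite: Tao2016AveragedNS, §1.1 Thm. 1.5 (p. 7)]

BARRIER (structured block, D-0021):
technique_class: energy-identity harmonic-analysis energy-methods energy-estimates function-space-estimates littlewood-paley abstract-bilinear-estimates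
blocks: the mild-solution form of NavierStokesRegularity — Tao's Conj. 1.2, equivalent to the Clay-type Conj. 1.1 (`Literature.NS.NavierStokesExistenceSmoothR3` for Schwartz data) by his Lemma 1.3, and its averaged analogue `Literature.Analysis.FluidPDE.Tao2016.GlobalRegularity 𝒜` — by "any proposed positive solution to the regularity problem which does not use the finer structure of the nonlinearity", i.e. strategies "based on treating the bilinear Euler operator `B` abstractly": combining the energy identity (1.7) / cancellation (1.2) `⟨B(u,u),u⟩ = 0` with the harmonic-analysis estimates for the heat equation and for `B` in Sobolev `W^{s,p}` (`1 < p < ∞`), Hölder, Besov or Morrey spaces [cite: Tao2016AveragedNS, §1.1 pp. 3–5 and 7–8].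
because: Thm. 1.5 as printed (and as stated by this entry): for some symmetric averaged Euler bilinear operator `B̃` with the cancellation property and some Schwartz divergence-free datum there is no global-in-time mild solution `u : [0,∞) → H¹⁰_df` [cite: Tao2016AveragedNS, §1.1 Thm. 1.5] (the local solution is unique, footnote p. 5, and its `H¹⁰_df` norm diverges at some `T_* < ∞`, remark after Thm. 1.5), proved in print from Thm. 3.2 (local cascade operators are averaged Euler operators) and Thm. 3.3 (blow-up for a local cascade equation, via Lemma 4.1, Thm. 4.2 and Thm. 6.2) [cite: Tao2016AveragedNS, §3 p. 14 and §4 pp. 21–23] and in the tree (`Tao2016.averagedNS_blowup_holds`); since `B̃` obeys the energy identity and inherits every such function-space estimate of `B` (pp. 6–7), an argument in the blocked class would prove the false statement `GlobalRegularity 𝒜` for Tao's datum — "any strategy that fails to distinguish between the Euler bilinear operator `B` and its averaged counterparts `B̃` … is doomed to failure" [cite: Tao2016AveragedNS, §1.1 pp. 6–8].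
evasions_known: arguments exploiting properties of `B` not shared by the averages, as listed by Tao: the backward-uniqueness / unique-continuation route to regularity under a bounded critical norm, which controls the nonlinearity pointwise by `u, ∇u` in vorticity form [cite: EscauriazaSereginSverak2003, Thms. 1.3–1.4] [cite: Tao2016AveragedNS, §1.1 p. 8]; large-data global solutions for data varying slowly in one direction, relying on algebraic properties of the symbol of `B` [cite: CheminGallagherPaicu2011, main theorem as reported by Tao 2016 §1.1 p. 8]. Earlier model blow-ups without the energy identity (cheap Navier–Stokes [cite: MontgomerySmith2001, Thm. 1], Gallagher–Paicu, Li–Sinai) are recorded by Tao as predecessors [cite: Tao2016AveragedNS, §1.1 p. 5].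
scope_caveats: (i) Thm. 1.5 — and the Lean body — is an existence statement about one constructed operator and one datum; the estimate-inheritance that gives it its barrier force ("every estimate on the Euler bilinear operator `B` in Sobolev spaces `W^{s,p}(ℝ³)` with `1 < p < ∞` implies a corresponding estimate for averaged Euler bilinear operators `B̃`", likewise in Hölder, Besov, Morrey spaces, so that "the local theory (and related theory, such as the concentration-compactness theory) for [the averaged equation (1.9)] is essentially identical to that of [the projected Navier–Stokes equation (1.6)]") is asserted for the class (1.13) but "we will not attempt to formalise this assertion here", and it is NOT part of the Lean statement, so the blocking inference of `because:` is informal exactly as in the source [cite: Tao2016AveragedNS, §1.1 pp. 6–7]; (ii) estimates in endpoint spaces `L¹`, `L^∞`, `L^{1,∞}` are not inherited [cite: Tao2016AveragedNS, §1.1 footnote p. 7]; (iii) the constructed blow-up is Type II, so arguments excluding only Type I blow-up (bounded critical norm) are not addressed by it [cite: Tao2016AveragedNS, §1.1 footnote p. 8]; (iv) Tao rates it "a significant (but not completely inpenetrable) barrier", the construction being "admittedly rather artificial" [cite: Tao2016AveragedNS, §1.1 p. 8]; (v) three space dimensions and the `H¹⁰_df` mild formulation; other formulations/dimensions are only asserted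 informally [cite: Tao2016AveragedNS, §1.1 footnote p. 3], and supercritical hyperdissipation `(-Δ)^α`, `α < 5/4`, only in a footnote [cite: Tao2016AveragedNS, §1.2 footnote p. 8]; (vi) rendering: `AveragingDatum` records the measurability of the random symbols pointwise (`ω ↦ m_{i,ω}(ξ)`, `ξ ≠ 0`) instead of Borel measurability into the Fréchet space `𝓜₀`, which Tao's hypothesis implies, so the Lean class of averaging data is at most wider than (1.13) and the Lean existence statement at most formally weaker than, and implied by, the printed one [cite: Tao2016AveragedNS, §1.1 p. 6 and (1.13)]; the identity (1.15) in `(H¹⁰_df)*` is recorded as the identity of `L²` pairings against every `w ∈ H¹⁰_df` with the (self-transposed) heat semigroup moved onto `w`, and real fields sit inside `L²(ℝ³; ℂ³)` cut out by an a.e.-reality predicate (module docstring of `TaoAveragedSobolev.lean`) [cite: Tao2016AveragedNS, §1.1 (1.15)]; (vii) history: until 2026-08-15 the entry's body was the function-level rendering `Literature.Analysis.FluidPDE.tao_averaged_ns_blowup` — real-valued symbols of which only the even part acts (a class not containing Tao's `𝓜₀`-averages), no moment or dilation bounds, the operator pinned on all fields by Bochner surrogates, a pointwise Duhamel identity — which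 is neither implied by nor implies Thm. 1.5 and is deprecated in its own file; statements made about "`TaoAveragedBlowup`" before that date concern the printed theorem its docstring stated, not that body [cite: Tao2016AveragedNS, §1.1 p. 6 and (1.12)–(1.15)].
status: established -/
def TaoAveragedBlowup : Prop :=
  Literature.Analysis.FluidPDE.Tao2016.averagedNS_blowup

/-- `TaoAveragedBlowup` is, by definition, the in-tree named fact
`Literature.Analysis.FluidPDE.Tao2016.averagedNS_blowup` (Tao 2016, Thm. 1.5 as printed;
proved in the tree as `Tao2016.averagedNS_blowup_holds`). [cite: Tao2016AveragedNS, §1.1 Thm. 1.5] -/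
theorem taoAveragedBlowup_iff :
    TaoAveragedBlowup ↔ Literature.Analysis.FluidPDE.Tao2016.averagedNS_blowup :=
  Iff.rfl

/-- Consequence recorded by Tao (discussion around Thm. 1.5, §1.1 p. 5: any proof of
Conj. 1.1/1.2 "must either use finer structure of the Navier–Stokes equation …, or else must rely
crucially on some estimate or other property of the Euler bilinear operator `B` that is not
shared by the averaged operator `B̃`"): global regularity — the analogue
`Literature.Analysis.FluidPDE.Tao2016.GlobalRegularity 𝒜` of Conj. 1.2 for (1.9) — fails for
*some* symmetric averaging datum with the cancellation property; the in-tree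
`Tao2016.exists_not_globalRegularity` follows from the barrier fact.
[cite: Tao2016AveragedNS, §1.1 Thm. 1.5 and p. 5] -/
theorem TaoAveragedBlowup.exists_not_globalRegularity (h : TaoAveragedBlowup) :
    Literature.Analysis.FluidPDE.Tao2016.exists_not_globalRegularity :=
  Literature.Analysis.FluidPDE.Tao2016.exists_not_globalRegularity_of_blowup h

/-- **Synonym of the catalogue entry `TaoAveragedBlowup`** (Tao's Theorem 1.5 as printed):
*definitionally* the same in-tree named fact `Literature.Analysis.FluidPDE.Tao2016.averagedNS_blowup`
(`taoAveragedBlowupPrinted_iff`, `taoAveragedBlowupPrinted_iff_taoAveragedBlowup`). Introduced on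
2026-08-14, when the entry still carried the (since deprecated) function-level body, to put the
printed statement into the catalogue next to it; retained unchanged after the entry itself was
migrated to the printed statement (2026-08-15) because the sibling discharge file proves the
barrier under this name (`TaoAveragedBlowupPrinted_holds`, `TaoAveragedBlowupProofs.lean`) and
ledger items cite it. It carries no barrier block of its own (one catalogue entry:
`TaoAveragedBlowup`); prefer `TaoAveragedBlowup` in new references. A `Prop`-valued definition.
[cite: Tao2016AveragedNS, §1.1 Thm. 1.5] -/
def TaoAveragedBlowupPrinted : Prop :=
  Literature.Analysis.FluidPDE.Tao2016.averagedNS_blowup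

/-- `TaoAveragedBlowupPrinted` is, by definition, the in-tree named fact
`Literature.Analysis.FluidPDE.Tao2016.averagedNS_blowup`. [cite: Tao2016AveragedNS, §1.1 Thm. 1.5] -/
theorem taoAveragedBlowupPrinted_iff :
    TaoAveragedBlowupPrinted ↔ Literature.Analysis.FluidPDE.Tao2016.averagedNS_blowup :=
  Iff.rfl

/-- The two catalogue-side names agree: `TaoAveragedBlowupPrinted ↔ TaoAveragedBlowup`
(both are definitionally `Tao2016.averagedNS_blowup`). [cite: Tao2016AveragedNS, §1.1 Thm. 1.5] -/
theorem taoAveragedBlowupPrinted_iff_taoAveragedBlowup :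
    TaoAveragedBlowupPrinted ↔ TaoAveragedBlowup :=
  Iff.rfl

/-- Consequence recorded by Tao (discussion after Thm. 1.5): global regularity (the analogue of
Conj. 1.2 for (1.9)) fails for *some* symmetric averaged Euler bilinear operator with the
cancellation property — the in-tree `Tao2016.exists_not_globalRegularity` follows from the
printed barrier fact. [cite: Tao2016AveragedNS, §1.1 Thm. 1.5] -/
theorem TaoAveragedBlowupPrinted.exists_not_globalRegularity (h : TaoAveragedBlowupPrinted) :
    Literature.Analysis.FluidPDE.Tao2016.exists_not_globalRegularity :=
  Literature.Analysis.FluidPDE.Tao2016.exists_not_globalRegularity_of_blowup h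

end Literature.Barriers.NavierStokesRegularity
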